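import Summits.CriticalPhenomena.SAWScalingLimit.Theorems.SAWReversalUpgradePathUpgradeRSLECont
import Literature.Probability.RandomPlanarGeometry.ChordalReversibility
import HarnessLib

/-!
# Assembly phase `phase3_eps` of `stub_returnsDie` (crux `PathUpgradeR`,
stmt-CriticalPhenomena-18055, route `SAWReversalUpgrade`, line `bidir_windows`)

Landing target:
`Summits/CriticalPhenomena/SAWScalingLimit/Theorems/SAWReversalUpgradePathUpgradeRAsmEps.lean`
(`--supports stmt-CriticalPhenomena-18055`; registered anchor `stub_returnsDie_minPos`).

The lead's proof of `stub_returnsDie` (returns of the lattice curve have vanishing probability)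
compares the lattice curve with an SLE(8/3) reference sample through a cascade of deterministic
constants. This file is the "epsilon phase" of that cascade: given the radii, horizons and
quantile thresholds produced by the earlier phases (with their accumulated inequalities), it
chooses the two comparison scales `ε = ε'` below every relevant constant, records the (long but
elementary) list of numeric consequences consumed by the later phases, and draws the two
uniform-continuity quantiles `csh`, `csh'` of the forward / backward reference curves at
oscillation size `ε / 4` (`stub_sleCont` on `(D, φ)` at horizon `T + 1` and on `(D.swap, φ')` at
horizon `T' + 1`).

* `stub_returnsDie_minPos` (registered anchor): a finite list of positive reals has a positive
  lower bound;
* `PathUpgradeRAsm.phase3_eps`: the phase theorem (statement generated by the lead's assembly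
  script; consumed positionally by the final assembly).
-/

noncomputable section

open scoped ENNReal NNReal

namespace Summit.CriticalPhenomena.SAWScalingLimit.Theorems

/-- **Positive lower bound of a finite list of positive reals** (registered anchor
`stub_returnsDie_minPos` of crux `PathUpgradeR`, line `bidir_windows`): if every entry of
`l : List ℝ` is positive then some `ε > 0` lies below every entry (induction on `l`, taking
`min a ε` at the cons step; the empty list admits `ε = 1`). [folklore] -/
theorem stub_returnsDie_minPos : ∀ l : List ℝ, (∀ x ∈ l, 0 < x) → ∃ ε : ℝ, 0 < ε ∧ ∀ x ∈ l, ε ≤ x := by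
  intro l
  induction l with
  | nil => exact fun _ => ⟨1, one_pos, fun x hx => absurd hx List.not_mem_nil⟩
  | cons a l ih =>
    intro h
    obtain ⟨ε, hε, hεl⟩ := ih fun x hx => h x (List.mem_cons_of_mem a hx)
    refine ⟨min a ε, lt_min (h a List.mem_cons_self) hε, fun x hx => ?_⟩
    rcases List.mem_cons.1 hx with rfl | hx
    · exact min_le_left _ _
    · exact (min_le_right _ _).trans (hεl x hx)

namespace PathUpgradeRAsm

/-- **Epsilon phase of the constant cascade of `stub_returnsDie`.** Given the Dobrushin domain
`D` with forward / backward chordal uniformizers `φ`, `φ'`, the horizons `T`, `T'`, the tail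
index `N` and the constants of the earlier phases together with their inequalities, for every
budget `β > 0` there are scales `ε = ε' > 0` and moduli `csh, csh' > 0` such that: the numeric
block of inequalities used by the gate / perturbation lemmas holds (each entry is either a
hypothesis passed through or a linear consequence of `64 ε ≤ min (dS, rbW, μ, μ', d')`), the ten
linking inequalities of the margins phases hold, and the two uniform-continuity events of the
forward reference curve `φ̄ ∘ sleTrace (8/3) ω` on `[0, T + 2]` (modulus `csh`, oscillation
`ε / 4`) and of the backward one `φ̄' ∘ sleTrace (8/3) ω` on `[0, T' + 2]` (modulus `csh'`) have
`preWienerMeasure`-probability `≤ β` (`stub_sleCont`). The lower bound is produced by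
`stub_returnsDie_minPos` on the list `[dS, rbW, μ, μ', d']`. [folklore] -/
theorem phase3_eps : ∀ (D : Literature.Probability.RandomPlanarGeometry.DobrushinDomain) (φ : Literature.Probability.RandomPlanarGeometry.ConformalEquiv UpperHalfPlane.upperHalfPlaneSet D.carrier), D.IsChordalUniformizing φ → ∀ (φ' : Literature.Probability.RandomPlanarGeometry.ConformalEquiv UpperHalfPlane.upperHalfPlaneSet D.swap.carrier), D.swap.IsChordalUniformizing φ' → ∀ (T T' : NNReal) (N : ℕ) (ℓ ra rb ra' rb' raF rbF R2b rbP R2a raP rbW α₀ α₀' dB dB' c c₀ μ₀ c' c₁ μ₀' dS d' h₀q d'' h₀q' Rout Rout' r₁ r₁' τ τ₁ θ la L ρ₁ m₁ τ' τ₁' θ' la' L' ρ₁' m₁' w' μ' cν ν w μ : ℝ), 0 < ℓ → 0 < α₀ → 0 < α₀' → 0 < ra → 0 < rb → 0 < raF → raF ≤ ra / 4 → raF ≤ ra' → 0 < rbF → rbF ≤ rb / 4 → rbF ≤ rb' → ra ≤ ℓ → rb ≤ ℓ → 0 < R2b → 0 < rbP → rbP ≤ R2b / 2 → rbP ≤ rbF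 → 0 < R2a → 0 < raP → raP ≤ R2a / 2 → raP ≤ raF → 0 < rbW → rbW ≤ rbP / 2 → (N : ℝ) ≤ T → 0 < dB → 0 < dB' → 0 < μ₀ → 0 < μ₀' → 0 < dS → dS ≤ dB / 16 → dS ≤ dB' / 16 → dS ≤ μ₀ / 16 → dS ≤ μ₀' / 16 → dS ≤ raP / 16 → dS ≤ rbP / 16 → 0 < d' → 0 < h₀q → 0 < d'' → d'' ≤ d' / 4 → d'' ≤ (rbP - rbW) / 4 → 0 < h₀q' → 0 < Rout → Rout ≤ h₀q / 4 → 0 < Rout' → Rout' ≤ h₀q' / 4 → 0 < r₁ → 0 < r₁' → 0 < θ → 8 * θ < c₀ → 2 ≤ L → 0 < ρ₁ → 1 / 64 ≤ m₁ → Rout ≤ 1 / 64 → 5 * (ρ₁ + Real.sqrt (θ + 4 * w)) ≤ r₁ → (L + 1) * θ + w ≤ 1 → 0 < w → w < θ / 2 → 3 * w ≤ c₀ → w ≤ 1 → 0 < θ' → 8 * θ' < c₁ → 2 ≤ L' → 0 < ρ₁' → 1 / 64 ≤ m₁' → Rout' ≤ 1 / 64 → 5 * (ρ₁' + Real.sqrt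 (θ' + 4 * w')) ≤ r₁' → (L' + 1) * θ' + w' ≤ 1 → 0 < w' → w' < θ' / 2 → w' ≤ c₁ → 0 < μ' → ν = μ' / 4 → 0 < μ → ∀ β : ENNReal, 0 < β → ∃ (ε ε' csh csh' : ℝ), (0 < ε ∧ 0 < ε' ∧ 5 * ε < μ ∧ 5 * ε' < μ' ∧ 0 < w ∧ 0 < w' ∧ w < θ / 2 ∧ w' < θ' / 2 ∧ 8 * θ < c₀ ∧ 8 * θ' < c₁ ∧ 2 ≤ L ∧ 2 ≤ L' ∧ (L + 1) * θ + w ≤ 1 ∧ (L' + 1) * θ' + w' ≤ 1 ∧ 0 ≤ ρ₁ ∧ 0 ≤ ρ₁' ∧ 0 < r₁ ∧ 0 < r₁' ∧ 5 * (ρ₁ + Real.sqrt (θ + 4 * w)) ≤ r₁ ∧ 5 * (ρ₁' + Real.sqrt (θ' + 4 * w')) ≤ r₁' ∧ 0 < Rout ∧ 0 < Rout' ∧ Rout ≤ m₁ ∧ Rout' ≤ m₁' ∧ Rout ≤ (h₀q / 2) ∧ Rout' ≤ (h₀q' / 2) ∧ 0 ≤ dS ∧ (μ₀ / 4) + 5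 * ε + 2 * dS < μ₀ ∧ (μ₀' / 4) + 5 * ε' + 2 * dS < μ₀' ∧ 3 * ε < dB ∧ 3 * ε' < dB' ∧ 2 * dS + 2 * ε < dB ∧ 2 * dS + 2 * ε' < dB' ∧ 0 < α₀ ∧ 0 < α₀' ∧ 3 * w ≤ c₀ ∧ w' ≤ c₁ ∧ 3 * ε + 3 * ε' < μ ∧ 3 * ε + 3 * ε' + ν < μ' ∧ 8 * ε + 8 * ε' ≤ μ₀ ∧ 2 * ε + 2 * dS < μ₀ ∧ 0 < rbW ∧ rbW < rbP ∧ rbP ≤ rbF ∧ 0 < raP ∧ raP ≤ raP ∧ raP ≤ raF ∧ raF ≤ ra / 4 ∧ raF ≤ ra' ∧ rbF ≤ rb / 4 ∧ rbF ≤ rb' ∧ ra ≤ ℓ ∧ rb ≤ ℓ ∧ 0 < ra ∧ 0 < rb ∧ ε ≤ ra / 4 ∧ ε ≤ rb / 4 ∧ (N : ℝ) + w ≤ T + 1 ∧ ε + 3 * ε' < 2 * dS ∧ ε' ≤ ε ∧ d'' ≤ d' - ε - ε' ∧ d'' ≤ rbP - rbW - ε' ∧ d'' ≤ d') ∧ (0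 < csh) ∧ (0 < csh') ∧ (raP / 2 ≤ raP - ε) ∧ (rbP / 2 ≤ rbP - ε') ∧ (raF / 2 < raF - ε) ∧ (rbF / 2 < rbF - ε) ∧ (raP + ε + 2 * dS ≤ R2a) ∧ (rbP + ε + 2 * dS ≤ R2b) ∧ (rbW / 2 < rbF - ε) ∧ (ε ≤ rbW / 2) ∧ (ε ≤ dS) ∧ (ℓ / 2 ≤ ℓ - 2 * ε) ∧ (Literature.Probability.Process.preWienerMeasure {ω | ∃ s t : NNReal, (s : ℝ) ≤ (T + 1) + 1 ∧ (t : ℝ) ≤ (T + 1) + 1 ∧ |(s : ℝ) - t| ≤ csh ∧ ε / 4 ≤ dist (φ.boundaryExtension (Literature.Probability.RandomPlanarGeometry.sleTrace ((8:NNReal)/3) ω s)) (φ.boundaryExtension (Literature.Probability.RandomPlanarGeometry.sleTrace ((8:NNReal)/3) ω t))} ≤ β) ∧ (Literature.Probability.Process.preWienerMeasure {ω | ∃ s t : NNReal, (s : ℝ) ≤ (T' + 1) + 1 ∧ (t : ℝ) ≤ (T' + 1) + 1 ∧ |(s : ℝ) - t| ≤ csh' ∧ ε' / 4 ≤ dist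 (φ'.boundaryExtension (Literature.Probability.RandomPlanarGeometry.sleTrace ((8:NNReal)/3) ω s)) (φ'.boundaryExtension (Literature.Probability.RandomPlanarGeometry.sleTrace ((8:NNReal)/3) ω t))} ≤ β) := by
  intro D φ hφ φ' hφ' T T' N ℓ ra rb ra' rb' raF rbF R2b rbP R2a raP rbW α₀ α₀' dB dB' _ c₀ μ₀ _ c₁ μ₀' dS d'
    h₀q d'' h₀q' Rout Rout' r₁ r₁' _ _ θ _ L ρ₁ m₁ _ _ θ' _ L' ρ₁' m₁' w' μ' _ ν w μ hℓ hα₀ hα₀' hra hrb hraF hraF4 hraF'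
    hrbF hrbF4 hrbF' hraℓ hrbℓ hR2b hrbP hrbP2 hrbPF hR2a hraP hraP2 hraPF hrbW hrbW2 hNT hdB hdB' hμ₀ hμ₀' hdS hdS1 hdS2
    hdS3 hdS4 hdS5 hdS6 hd' hh₀q hd'' hd''4 hd''r hh₀q' hRout hRout4 hRout' hRout'4 hr₁ hr₁' hθ hθc₀ hL hρ₁ hm₁ hRout64
    hr₁5 hLθ hw hwθ hwc₀ hw1 hθ' hθ'c₁ hL' hρ₁' hm₁' hRout'64 hr₁'5 hL'θ' hw' hw'θ' hw'c₁ hμ' hν hμ β hβ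
  -- a common positive lower bound `m` of the five "bottleneck" constants
  obtain ⟨m, hm, hml⟩ := stub_returnsDie_minPos [dS, rbW, μ, μ', d'] (by
    intro x hx
    simp only [List.mem_cons, List.not_mem_nil, or_false] at hx
    rcases hx with rfl | rfl | rfl | rfl | rfl <;> assumption)
  simp only [List.forall_mem_cons] at hml
  obtain ⟨hmdS, hmrbW, hmμ, hmμ', hmd', -⟩ := hml
  -- the two uniform-continuity quantiles at oscillation size `ε / 4`, `ε := m / 64`
  obtain ⟨csh, hcsh, hP⟩ := stub_sleCont D φ hφ (T + 1) (m / 64 / 4) (by positivity) β hβ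
  obtain ⟨csh', hcsh', hP'⟩ := stub_sleCont D.swap φ' hφ' (T' + 1) (m / 64 / 4) (by positivity) β hβ
  simp only [NNReal.coe_add, NNReal.coe_one] at hP hP'
  refine ⟨m / 64, m / 64, csh, csh', ?_, hcsh, hcsh', ?_, ?_, ?_, ?_, ?_, ?_, ?_, ?_, ?_, ?_, hP, hP'⟩
  · constructorm* _ ∧ _
    all_goals first | assumption | positivity | linarith
  all_goals linarith

end PathUpgradeRAsm

end Summit.CriticalPhenomena.SAWScalingLimit.Theorems

end
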